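import Summits.Ventures.LatticeQCDFlow.Scoring.SU2TorusStripMerging
import Summits.Ventures.LatticeQCDFlow.Scoring.SU2TorusPartitionFunction
import HarnessLib

/-!
# SU(2) on the 2-torus: the lattice rectangle as a set of plaquettes — bookkeeping for Wilson loops

HONEST FRAMING: exact (Metropolis-corrected) sampling algorithms for lattice gauge theory;
figures of merit are autocorrelation/cost numbers at stated couplings and volumes; no
continuum-physics claim.

Venture `LatticeQCDFlow` (cell pub-lqcd), sub-topic `Scoring`; FANOUT row 5 (`s0-sun-a`), GEN-11.
NEW WORK of the cell (placement rule); combinatorial bookkeeping for the exact SU(2) torus Wilson loops.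
For a corner `(i,j)` and sizes `R, T ≤ L` the rectangle `A = {(i+a, j+b) : a < R, b < T}` of `(ℤ/L)²` is
the `Finset` image of `range R ×ˢ range T`; its boundary holonomy is
`W_{R×T} = [h(i,j)⋯h(i+R−1,j)]·[v(i+R,j)⋯v(i+R,j+T−1)]·[h(i,j+T)⋯h(i+R−1,j+T)]⁻¹·[v(i,j)⋯v(i,j+T−1)]⁻¹`.

* `mem_rect`, `rect_injOn`, `card_rectSites` (`= RT`), `prod_rect_eq` (`∏_{x∈A} = ∏_{b<T}∏_{a<R}`),
  `prod_rect_piecewise` (`∏_p c(u on A, v off A) = c_u^{RT} c_v^{L²−RT}`);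
* `plaquetteHolonomy_update_rect_vert/horiz` — a plaquette OFF the rectangle does not contain its
  interior links; `loop_update_rect_vert/horiz` — neither does the loop `W_{R×T}`.

Elementary; nothing is cited; no `def`.
-/

noncomputable section

open Real MeasureTheory Set Function Finset Polynomial.Chebyshev
open Literature.MathematicalPhysics.QuantumFieldTheory Literature.MathematicalPhysics.QuantumLattice
open Summit.Ventures.LatticeQCDFlow.Exactness
open Summit.Ventures.LatticeQCDFlow.Theory2.Lattice

namespace Summit.Ventures.LatticeQCDFlow.Scoring

variable {L : ℕ}

/-! ## §1. The rectangle of sites -/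

/-- The sites `(i+a, j+b)`, `a < R`, `b < T`, belong to the rectangle. -/
theorem mem_rect (i j : ZMod L) {R T a b : ℕ} (ha : a < R) (hb : b < T) :
    (![i + a, j + b] : Site 2 L) ∈
      (range R ×ˢ range T).image (fun p : ℕ × ℕ => (![i + p.1, j + p.2] : Site 2 L)) :=
  Finset.mem_image.mpr ⟨(a, b), Finset.mem_product.mpr ⟨Finset.mem_range.mpr ha, Finset.mem_range.mpr hb⟩, rfl⟩

/-- The parametrisation of the rectangle is injective (`R, T ≤ L`). -/
theorem rect_injOn (i j : ZMod L) {R T : ℕ} (hRL : R ≤ L) (hTL : T ≤ L) :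
    Set.InjOn (fun p : ℕ × ℕ => (![i + p.1, j + p.2] : Site 2 L)) ↑(range R ×ˢ range T) := by
  intro p hp q hq h
  rw [Finset.coe_product, Set.mem_prod, Finset.coe_range, Finset.coe_range, Set.mem_Iio, Set.mem_Iio] at hp hq
  have h' := vec2_eq_iff.mp h
  refine Prod.ext (Classical.byContradiction fun hne => ?_) (Classical.byContradiction fun hne => ?_)
  · exact natCast_zmod_ne_of_lt (by omega) (by omega) hne (add_left_cancel h'.1)
  · exact natCast_zmod_ne_of_lt (by omega) (by omega) hne (add_left_cancel h'.2)

/-- The rectangle has `RT` sites (`R, T ≤ L`). -/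
theorem card_rectSites (i j : ZMod L) {R T : ℕ} (hRL : R ≤ L) (hTL : T ≤ L) :
    ((range R ×ˢ range T).image (fun p : ℕ × ℕ => (![i + p.1, j + p.2] : Site 2 L))).card = R * T := by
  rw [Finset.card_image_of_injOn (rect_injOn i j hRL hTL), Finset.card_product, Finset.card_range,
    Finset.card_range]

/-- A product over the rectangle is the double product over its parametrisation. -/
theorem prod_rect_eq {M : Type*} [CommMonoid M] (i j : ZMod L) {R T : ℕ} (hRL : R ≤ L) (hTL : T ≤ L)
    (g : Site 2 L → M) :
    ∏ x ∈ (range R ×ˢ range T).image (fun p : ℕ × ℕ => (![i + p.1, j + p.2] : Site 2 L)), g x =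
      ∏ b ∈ range T, ∏ a ∈ range R, g ![i + a, j + b] := by
  rw [Finset.prod_image (rect_injOn i j hRL hTL), Finset.prod_product_right]

/-- The product of character coefficients of a plaquette assignment that is `u` on the rectangle and
`v` off it: `c_u^{RT} · c_v^{L²−RT}`. -/
theorem prod_rect_piecewise [NeZero L] (c : ℕ → ℝ) (i j : ZMod L) {R T : ℕ} (hRL : R ≤ L) (hTL : T ≤ L)
    (u v : ℕ) :
    ∏ p : Plaquette 2 L, c (if p.1 ∈ (range R ×ˢ range T).image
        (fun q : ℕ × ℕ => (![i + q.1, j + q.2] : Site 2 L)) then u else v) =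
      c u ^ (R * T) * c v ^ (L ^ 2 - R * T) := by
  set A := (range R ×ˢ range T).image (fun q : ℕ × ℕ => (![i + q.1, j + q.2] : Site 2 L)) with hA
  rw [prod_plaquette_two, ← Finset.prod_mul_prod_compl A]
  have h1 : ∏ s ∈ A, c (if ((s, (⟨((0 : Fin 2), (1 : Fin 2)), by decide⟩ :
      {p : Fin 2 × Fin 2 // p.1 < p.2})) : Plaquette 2 L).1 ∈ A then u else v) = ∏ s ∈ A, c u :=
    Finset.prod_congr rfl fun s hs => by rw [if_pos hs]
  have h2 : ∏ s ∈ Aᶜ, c (if ((s, (⟨((0 : Fin 2), (1 : Fin 2)), by decide⟩ :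
      {p : Fin 2 × Fin 2 // p.1 < p.2})) : Plaquette 2 L).1 ∈ A then u else v) = ∏ s ∈ Aᶜ, c v :=
    Finset.prod_congr rfl fun s hs => by rw [if_neg (Finset.mem_compl.mp hs)]
  rw [h1, h2, Finset.prod_const, Finset.prod_const, Finset.card_compl, card_rectSites i j hRL hTL,
    Flux.card_site_two]

/-- A plaquette OFF the rectangle does not contain its interior vertical links `v(i+a,j+b)`,
`0 < a < R`, `b < T`. -/
theorem plaquetteHolonomy_update_rect_vert {G : Type*} [Group G] (i j : ZMod L) {R T : ℕ}
    {x : Site 2 L} (hx : x ∉ (range R ×ˢ range T).image (fun p : ℕ × ℕ => (![i + p.1, j + p.2] : Site 2 L)))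
    {a b : ℕ} (ha0 : 0 < a) (haR : a < R) (hb : b < T) (V : GaugeConfig 2 L G) (g : G) :
    plaquetteHolonomy (update V (![i + a, j + b], 1) g) x 0 1 = plaquetteHolonomy V x 0 1 := by
  refine TwoDim.plaquetteHolonomy_update_vert g (fun h => hx (h ▸ mem_rect i j haR hb)) fun h => hx ?_
  rw [← site_two_eta x, shift_vec2_zero, vec2_eq_iff] at h
  have hx0 : x 0 = i + ((a - 1 : ℕ) : ZMod L) := by
    rw [Nat.cast_pred ha0, ← add_sub_assoc, ← h.1, add_sub_cancel_right]
  rw [← site_two_eta x, hx0, h.2]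
  exact mem_rect i j (by omega) hb

/-- A plaquette OFF the rectangle does not contain its interior horizontal links `h(i,j+b)`,
`0 < b < T`. -/
theorem plaquetteHolonomy_update_rect_horiz {G : Type*} [Group G] (i j : ZMod L) {R T : ℕ}
    {x : Site 2 L} (hx : x ∉ (range R ×ˢ range T).image (fun p : ℕ × ℕ => (![i + p.1, j + p.2] : Site 2 L)))
    (hR : 1 ≤ R) {b : ℕ} (hb0 : 0 < b) (hbT : b < T) (V : GaugeConfig 2 L G) (g : G) :
    plaquetteHolonomy (update V (![i, j + b], 0) g) x 0 1 = plaquetteHolonomy V x 0 1 := by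
  have hmem : (![i, j + b] : Site 2 L) ∈
      (range R ×ˢ range T).image (fun p : ℕ × ℕ => (![i + p.1, j + p.2] : Site 2 L)) := by
    have := mem_rect i j (R := R) (T := T) (a := 0) (b := b) (by omega) hbT
    rwa [Nat.cast_zero, add_zero] at this
  refine TwoDim.plaquetteHolonomy_update_horiz g (fun h => hx (h ▸ hmem)) fun h => hx ?_
  rw [← site_two_eta x, shift_vec2_one, vec2_eq_iff] at h
  have hx1 : x 1 = j + ((b - 1 : ℕ) : ZMod L) := by
    rw [Nat.cast_pred hb0, ← add_sub_assoc, ← h.2, add_sub_cancel_right]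
  rw [← site_two_eta x, hx1, h.1]
  have := mem_rect i j (R := R) (T := T) (a := 0) (b := b - 1) (by omega) (by omega)
  rwa [Nat.cast_zero, add_zero] at this

/-- The loop `W_{R×T}` does not contain the interior vertical links of its rectangle. -/
theorem loop_update_rect_vert (i j : ZMod L) {R T : ℕ} (hRL : R ≤ L) {a : ℕ} (b : ℕ) (ha0 : 0 < a)
    (haR : a < R)
    (V : GaugeConfig 2 L (Matrix.specialUnitaryGroup (Fin 2) ℂ)) (g : Matrix.specialUnitaryGroup (Fin 2) ℂ) :
    (((List.range R).map fun a' : ℕ => update V (![i + a, j + b], 1) g (![i + a', j], 0)).prod *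
        ((List.range T).map fun b' : ℕ => update V (![i + a, j + b], 1) g (![i + R, j + b'], 1)).prod *
        (((List.range R).map fun a' : ℕ => update V (![i + a, j + b], 1) g (![i + a', j + T], 0)).prod)⁻¹ *
        (((List.range T).map fun b' : ℕ => update V (![i + a, j + b], 1) g (![i, j + b'], 1)).prod)⁻¹) =
      ((List.range R).map fun a : ℕ => V (![i + a, j], 0)).prod *
        ((List.range T).map fun b' : ℕ => V (![i + R, j + b'], 1)).prod *
        (((List.range R).map fun a : ℕ => V (![i + a, j + T], 0)).prod)⁻¹ *
        (((List.range T).map fun b' : ℕ => V (![i, j + b'], 1)).prod)⁻¹ := by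
  have hRa : (a : ZMod L) ≠ (R : ZMod L) := natCast_zmod_ne_of_pos_lt_le ha0 haR hRL
  have ha : (a : ZMod L) ≠ 0 := fun h =>
    absurd (Nat.le_of_dvd ha0 ((ZMod.natCast_eq_zero_iff a L).1 h)) (by omega)
  rw [list_prod_map_update_of_ne V _ g _ (fun a' : ℕ => ((![i + a', j], 0) : Edge 2 L))
      fun k _ h => Fin.zero_ne_one (congrArg Prod.snd h),
    list_prod_map_update_of_ne V _ g _ (fun b' : ℕ => ((![i + R, j + b'], 1) : Edge 2 L))
      fun k _ h => hRa.symm (add_left_cancel (vec2_eq_iff.mp (congrArg Prod.fst h)).1),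
    list_prod_map_update_of_ne V _ g _ (fun a' : ℕ => ((![i + a', j + T], 0) : Edge 2 L))
      fun k _ h => Fin.zero_ne_one (congrArg Prod.snd h),
    list_prod_map_update_of_ne V _ g _ (fun b' : ℕ => ((![i, j + b'], 1) : Edge 2 L))
      fun k _ h => ha (left_eq_add.mp (vec2_eq_iff.mp (congrArg Prod.fst h)).1)]

/-- The loop `W_{R×T}` does not contain the interior horizontal links of its rectangle. -/
theorem loop_update_rect_horiz (i j : ZMod L) {R T : ℕ} (hTL : T ≤ L) {b : ℕ} (hb0 : 0 < b) (hbT : b < T)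
    (V : GaugeConfig 2 L (Matrix.specialUnitaryGroup (Fin 2) ℂ)) (g : Matrix.specialUnitaryGroup (Fin 2) ℂ) :
    (((List.range R).map fun a : ℕ => update V (![i, j + b], 0) g (![i + a, j], 0)).prod *
        ((List.range T).map fun b' : ℕ => update V (![i, j + b], 0) g (![i + R, j + b'], 1)).prod *
        (((List.range R).map fun a : ℕ => update V (![i, j + b], 0) g (![i + a, j + T], 0)).prod)⁻¹ *
        (((List.range T).map fun b' : ℕ => update V (![i, j + b], 0) g (![i, j + b'], 1)).prod)⁻¹) =
      ((List.range R).map fun a : ℕ => V (![i + a, j], 0)).prod *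
        ((List.range T).map fun b' : ℕ => V (![i + R, j + b'], 1)).prod *
        (((List.range R).map fun a : ℕ => V (![i + a, j + T], 0)).prod)⁻¹ *
        (((List.range T).map fun b' : ℕ => V (![i, j + b'], 1)).prod)⁻¹ := by
  have hbT' : (b : ZMod L) ≠ (T : ZMod L) := natCast_zmod_ne_of_pos_lt_le hb0 hbT hTL
  have hb : (b : ZMod L) ≠ 0 := fun h =>
    absurd (Nat.le_of_dvd hb0 ((ZMod.natCast_eq_zero_iff b L).1 h)) (by omega)
  rw [list_prod_map_update_of_ne V _ g _ (fun a' : ℕ => ((![i + a', j], 0) : Edge 2 L))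
      fun k _ h => hb (left_eq_add.mp (vec2_eq_iff.mp (congrArg Prod.fst h)).2),
    list_prod_map_update_of_ne V _ g _ (fun b' : ℕ => ((![i + R, j + b'], 1) : Edge 2 L))
      fun k _ h => Fin.zero_ne_one (congrArg Prod.snd h).symm,
    list_prod_map_update_of_ne V _ g _ (fun a' : ℕ => ((![i + a', j + T], 0) : Edge 2 L))
      fun k _ h => hbT'.symm (add_left_cancel (vec2_eq_iff.mp (congrArg Prod.fst h)).2),
    list_prod_map_update_of_ne V _ g _ (fun b' : ℕ => ((![i, j + b'], 1) : Edge 2 L))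
      fun k _ h => Fin.zero_ne_one (congrArg Prod.snd h).symm]

end Summit.Ventures.LatticeQCDFlow.Scoring
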